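import Summits.QuantumFields.BalabanUV.T4Continuum.Spine.NE1p.DressedSmallFieldRodRateWitness

/-!
# T⁴ programme, spine estimate NE1′ (node O3b/H2) — WITNESS W72 «THE CLUSTER TERM IS LIVE AND THE DECAY RATE BITES», PART 2 (GENERAL + GENUINE):
# `E_w(X)` for an activity supported on ONE polymer of footprint `X` (`exp E = 1 + w P` — ANY footprint) or on TWO INCOMPATIBLE polymers
# covering `X` (`exp E = (1 + w P + w Q)∕((1 + w P)(1 + w Q))` — the Kotecký–Preiss truncated function of the pair); on PART 1's datum the
# attached part of `E(C_R)` is the two-domino Ursell term, NOT zero, although NO active polymer has footprint `C_R`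

Cell `pub-balaban`, sub-cell `t4`, row NE1′ formalisation crew (`t4/formal/NE1p/LEAVES.md` row W72 ∕ DAG N29zzzza — BOOKED typer R-T139 `HOME/CLAIMS.log`
l.22796; INTENT l.22351, STAGED l.22576; PART 1 = p239676 ACCEPTED 8aab5018f967; X203 its read),
unit `b2b-balaban-t4-ne1p-formalise-leaf-09` (gen 13); PART 2 of 2 (D1) — imports PART 1 `Spine/NE1p/DressedSmallFieldRodRateWitness` ONLY and
re-enters its namespace; THEOREMS ONLY (0 def, 0 `def … : Prop`, 0 cite, 0 sorry, 0 `attribute`) + one closing `example`; nothing of PART 1 ∕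
N0o ∕ W24 ∕ W67 ∕ pv22 ∕ the tree's `ClusterExpansion`∕`PolymerGas`∕`PolymerPressure`∕`B13Resummation`∕`B13FamilySum` is restated —
`polymerPartitionFunction_insert`∕`_empty`, `hasDerivAt_polymerPartitionFunction_ray`, `polymerLogZ`∕`polymerLogZ_empty`, `truncatedWeight`∕
`truncatedWeight_empty`, `exp_polymerLogZ`, `sum_powerset_neg_one_pow_mul_apply_inter_eq_zero`, `locE`, `coveringFamilies`∕`mem_coveringFamilies`,
W24's `dressedConst_le_one`, W33's `Acst`∕`Acst_pos`, W67's `pR`∕`CR`, PART 1's `DA`∕`DB`∕`actAB`∕`cAB`∕`footprints`∕`rodRateOne_fires_closed` are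
used BY NAME.

* §5 GENERAL (any polymer type `P`, any symmetric incompatibility): a polymer of ZERO activity is invisible to `Z` (`polymerPartitionFunction_erase_of_zero`,
  the one-polymer recursion), to the ray derivative (`polymerRayDeriv_erase_of_zero`, uniqueness of the derivative), to the KP logarithm
  (`polymerLogZ_erase_of_zero`), and **KILLS every truncated function it belongs to** (`truncatedWeight_eq_zero_of_zero_mem`: [KP86] (3) is then
  an alternating sum seeing only `C ∖ {γ} ⊊ C` — the tree's `sum_powerset_neg_one_pow_mul_apply_inter_eq_zero`); the volumes of one polymer and
  of an INCOMPATIBLE pair (`1 + w P`, `1 + w P + w Q`), `Φ^T({P}) = log Z({P})`, `Φ^T({P,Q}) = log Z({P,Q}) − log Z({P}) − log Z({Q})`;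
* §6 GENERAL (any `B13Resummation.locE`): **single support** — `locE_eq_polymerLogZ_of_support_single`, `exp_locE_of_support_single`
  (`exp E_w(X) = 1 + w P`: W24's `locE_cube_eq`∕`exp_locE_cube` for ANY footprint `X = cubes P`); **pair support** —
  `locE_eq_truncatedWeight_of_support_pair` (the only covering family of `X` without a dead member is `{P, Q}`), `exp_locE_of_support_pair`;
* §7 ON PART 1's DATUM (`5 ≤ L`): `actAB_CR` (the rod itself is INACTIVE), `ttouch_DA_DB` (the dominoes overlap in `proj p₁`: incompatible for
  (2.11)'s ζ), `cAB_lt_half`, **`exp_locE_rod`: `exp E_{H_1}(C_R) = (1 + 2c)∕(1 + c)²`** (i.e. `E_{H_1}(C_R) = log(1 + 2c) − 2 log(1 + c) = −c² + O(c³)`,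
  (2.13) at n = 2 with `ρ^T(D_A, D_B) = −1`), `exp_locE_rod_zero`, **`rodCluster_live`**, and the closing `example` «liveness ∧ PART 1's bound
  `≤ 2·K₀(64,8)·e^{−6}` on the SAME datum».

HONEST FRAMING as PART 1: §5–§6 are [folklore] lemmas about the tree's OWN Kotecký–Preiss objects (no Bałaban object in them); §7 is a
DECIDED TOY; nothing asserted about Bałaban's densities or about print's `ρ^T`; 0 binders instantiated on Bałaban's densities; no wall item;
wall v1.8 (T4-DAG v48) — words, not kind — does NOT move; R-t4r2-Q2 NOT met; NE1′ ⇐ the named binders — NOT proved, NOT printed; spine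
PROVED 0∕9; count 9 unchanged.  Rung (B)+1 on ONE finite four-torus — NOT infinite volume, NOT a mass gap, NOT OS on ℝ⁴, NOT Clay.
HONEST DEPENDENCY: continuum YM on T⁴ ⇐ BetaPertH ∧ nine spine estimates (0/9 proved); BetaPertH ⇐ (D1) ∧ (D4) ∧ CAP+tail; G-an2-4
gates asym, D1 and NE2/3/4.
-/

noncomputable section

namespace Summit.QuantumFields.BalabanUV.T4Continuum.NE1p.DressedSmallFieldRodRateWitness

open Set Metric Complex
open scoped BigOperators
open Literature.Probability.LatticeModels (polymerPartitionFunction polymerPartitionFunction_insert polymerPartitionFunction_empty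
  polymerRayDeriv hasDerivAt_polymerPartitionFunction_ray polymerLogZ polymerLogZ_empty truncatedWeight truncatedWeight_empty exp_polymerLogZ
  sum_powerset_neg_one_pow_mul_apply_inter_eq_zero)
open Literature.MathematicalPhysics.QuantumFieldTheory.Balaban1983to89
open Literature.MathematicalPhysics.QuantumFieldTheory.Balaban1983to89.B12TreeDecay (K₀ K₀_pos)
open Literature.MathematicalPhysics.QuantumFieldTheory.Balaban1983to89.B13Resummation (locE)
open Literature.MathematicalPhysics.QuantumFieldTheory.Balaban1983to89.B13FamilySum (coveringFamilies mem_coveringFamilies)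
open Literature.MathematicalPhysics.QuantumFieldTheory.Balaban1983to89.TreeLengthTorus (TPt TDom tsys proj)
open Literature.MathematicalPhysics.QuantumFieldTheory.Balaban1983to89.TreeLengthTorusGeometry (tgeometry TTouch ttouch_symm)
open Summit.QuantumFields.BalabanUV.T4Continuum.NE1p.DressedSmallFieldTorusWitness (dressedConst_le_one)
open Summit.QuantumFields.BalabanUV.T4Continuum.NE1p.DressedSmallFieldCoresWitness (Acst Acst_pos)
open Summit.QuantumFields.BalabanUV.T4Continuum.NE1p.DressedSmallFieldNestedToriRod (pR rodT CR CR_val)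

/-! ## §5 GENERAL: a polymer of ZERO activity is invisible to `Z`, to its ray derivative, to `log Z`, and KILLS every truncated function it
belongs to -/

section ZeroActivity
variable {P : Type*} [DecidableEq P] {inc : P → P → Prop} [DecidableRel inc]

/-- A polymer of zero activity can be erased from the volume: `Z(Λ; w) = Z(Λ ∖ {γ}; w)` (the one-polymer recursion). [folklore] -/
theorem polymerPartitionFunction_erase_of_zero (hsymm : ∀ a b, inc a b → inc b a) (w : P → ℂ) {γ : P} (hγ : w γ = 0)
    (Λ : Finset P) : polymerPartitionFunction inc w Λ = polymerPartitionFunction inc w (Λ.erase γ) := by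
  by_cases h : γ ∈ Λ
  · conv_lhs => rw [← Finset.insert_erase h]
    rw [polymerPartitionFunction_insert hsymm w (Finset.notMem_erase γ Λ), hγ, zero_mul, add_zero]
  · rw [Finset.erase_eq_of_notMem h]

/-- … and from the ray derivative `d∕dt Z(Λ; t•w)` (uniqueness of the derivative of the SAME function of `t`). [folklore] -/
theorem polymerRayDeriv_erase_of_zero (hsymm : ∀ a b, inc a b → inc b a) (w : P → ℂ) {γ : P} (hγ : w γ = 0) (Λ : Finset P)
    (t : ℝ) : polymerRayDeriv inc w Λ t = polymerRayDeriv inc w (Λ.erase γ) t := by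
  have h1 := hasDerivAt_polymerPartitionFunction_ray (inc := inc) w Λ t
  have h2 := hasDerivAt_polymerPartitionFunction_ray (inc := inc) w (Λ.erase γ) t
  have hfun : (fun s : ℝ => polymerPartitionFunction inc (fun γ' => (s : ℂ) * w γ') Λ) =
      fun s : ℝ => polymerPartitionFunction inc (fun γ' => (s : ℂ) * w γ') (Λ.erase γ) :=
    funext fun s => polymerPartitionFunction_erase_of_zero hsymm _ (by rw [hγ, mul_zero]) Λ
  rw [hfun] at h1
  exact h1.unique h2

/-- … hence from the Kotecký–Preiss logarithm: `log Z(Λ; w) = log Z(Λ ∖ {γ}; w)`. [folklore] -/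
theorem polymerLogZ_erase_of_zero (hsymm : ∀ a b, inc a b → inc b a) (w : P → ℂ) {γ : P} (hγ : w γ = 0) (Λ : Finset P) :
    polymerLogZ inc w Λ = polymerLogZ inc w (Λ.erase γ) := by
  unfold polymerLogZ
  refine intervalIntegral.integral_congr fun t _ => ?_
  rw [polymerRayDeriv_erase_of_zero hsymm w hγ Λ t,
    polymerPartitionFunction_erase_of_zero hsymm _ (show (t : ℂ) * w γ = 0 by rw [hγ, mul_zero]) Λ]

/-- **A TRUNCATED FUNCTION CONTAINING A POLYMER OF ZERO ACTIVITY VANISHES**: `Φ^T(C) = Σ_{B ⊆ C} (−1)^{|C∖B|} log Z(B)` ([KP86] (3)) with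
`log Z(B) = log Z(B ∖ {γ})` is an alternating sum seeing only `C ∖ {γ} ⊊ C` (the tree's `sum_powerset_neg_one_pow_mul_apply_inter_eq_zero`). [folklore] -/
theorem truncatedWeight_eq_zero_of_zero_mem (hsymm : ∀ a b, inc a b → inc b a) (w : P → ℂ) {γ : P} (hγ : w γ = 0) {C : Finset P}
    (hC : γ ∈ C) : truncatedWeight inc w C = 0 := by
  unfold truncatedWeight
  have h : ∀ B ∈ C.powerset, (-1 : ℂ) ^ (C \ B).card * polymerLogZ inc w B =
      (-1 : ℂ) ^ (C \ B).card * polymerLogZ inc w (B ∩ C.erase γ) := by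
    intro B hB
    rw [polymerLogZ_erase_of_zero hsymm w hγ B]
    congr 2
    ext x
    simp only [Finset.mem_erase, Finset.mem_inter]
    exact ⟨fun ⟨hx, hxB⟩ => ⟨hxB, hx, Finset.mem_powerset.1 hB hxB⟩, fun ⟨hxB, hx, _⟩ => ⟨hx, hxB⟩⟩
  rw [Finset.sum_congr rfl h]
  exact sum_powerset_neg_one_pow_mul_apply_inter_eq_zero (polymerLogZ inc w) (Finset.erase_subset γ C)
    ⟨γ, Finset.mem_sdiff.2 ⟨hC, Finset.notMem_erase γ C⟩⟩

/-- The one-polymer volume: `Z({P}; w) = 1 + w P`. [folklore] -/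
theorem polymerPartitionFunction_single (hsymm : ∀ a b, inc a b → inc b a) (w : P → ℂ) (p : P) :
    polymerPartitionFunction inc w {p} = 1 + w p := by
  rw [← Finset.insert_empty, polymerPartitionFunction_insert hsymm w (Finset.notMem_empty _)]; simp

/-- The two-polymer volume of an INCOMPATIBLE pair: `Z({P, Q}; w) = 1 + w P + w Q` (no compatible pair — the product term is absent). [folklore] -/
theorem polymerPartitionFunction_pair_of_inc (hsymm : ∀ a b, inc a b → inc b a) (w : P → ℂ) {p q : P} (hpq : p ≠ q)
    (hinc : inc p q) : polymerPartitionFunction inc w {p, q} = 1 + w p + w q := by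
  rw [polymerPartitionFunction_insert hsymm w (by simpa using hpq), polymerPartitionFunction_single hsymm]
  have hf : ({q} : Finset P).filter (fun γ' => ¬ inc p γ') = ∅ := by
    rw [Finset.filter_singleton, if_neg (not_not.2 hinc)]
  rw [hf, polymerPartitionFunction_empty]; ring

/-- `Φ^T({P}) = log Z({P})` (Möbius over `∅ ⊆ {P}`; `log Z(∅) = 0`). [folklore] -/
theorem truncatedWeight_single (w : P → ℂ) (p : P) : truncatedWeight inc w {p} = polymerLogZ inc w {p} := by
  unfold truncatedWeight
  have hp : ({p} : Finset P).powerset = {∅, {p}} := by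
    rw [← Finset.insert_empty, Finset.powerset_insert, Finset.powerset_empty]; simp
  rw [hp, Finset.sum_insert (by simp), Finset.sum_singleton]
  simp [polymerLogZ_empty]

/-- `Φ^T({P, Q}) = log Z({P,Q}) − log Z({P}) − log Z({Q})` for `P ≠ Q` (Möbius over the four subsets; `log Z(∅) = 0`). [folklore] -/
theorem truncatedWeight_pair (w : P → ℂ) {p q : P} (hpq : p ≠ q) :
    truncatedWeight inc w {p, q} = polymerLogZ inc w {p, q} - polymerLogZ inc w {p} - polymerLogZ inc w {q} := by
  unfold truncatedWeight
  rw [Finset.sum_powerset_insert (by simpa using hpq)]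
  have hp : ({q} : Finset P).powerset = {∅, {q}} := by
    rw [← Finset.insert_empty, Finset.powerset_insert, Finset.powerset_empty]; simp
  rw [hp, Finset.sum_insert (by simp), Finset.sum_singleton, Finset.sum_insert (by simp), Finset.sum_singleton]
  have h1 : ({p, q} : Finset P) \ ∅ = {p, q} := Finset.sdiff_empty
  have h2 : ({p, q} : Finset P) \ {q} = {p} := by
    ext x; simp only [Finset.mem_sdiff, Finset.mem_insert, Finset.mem_singleton]
    constructor
    · rintro ⟨h | h, hne⟩; exacts [h, absurd h hne]
    · rintro rfl; exact ⟨Or.inl rfl, hpq⟩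
  have h3 : ({p, q} : Finset P) \ insert p ∅ = {q} := by
    rw [Finset.insert_empty]
    ext x; simp only [Finset.mem_sdiff, Finset.mem_insert, Finset.mem_singleton]
    constructor
    · rintro ⟨h | h, hne⟩; exacts [absurd h hne, h]
    · rintro rfl; exact ⟨Or.inr rfl, hpq.symm⟩
  have h4 : ({p, q} : Finset P) \ insert p {q} = ∅ := Finset.sdiff_self _
  rw [h1, h2, h3, h4, Finset.insert_empty, Finset.card_empty, Finset.card_singleton, Finset.card_singleton,
    Finset.card_pair hpq, polymerLogZ_empty]
  ring

end ZeroActivity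

/-! ## §6 GENERAL: `E_w(X)` OF AN ACTIVITY SUPPORTED ON ONE POLYMER OF FOOTPRINT `X`, OR ON TWO INCOMPATIBLE POLYMERS COVERING `X` -/

section Support
variable {Dom Cube : Type*} [DecidableEq Dom] [DecidableEq Cube] [Fintype Dom] (ι : Dom → Dom → Prop) [DecidableRel ι]

/-- **SINGLE SUPPORT**: if, among the polymers inside `X`, the activity lives on ONE polymer `P` with footprint `X`, then
`E_w(X) = log Z({P}; w)` — every other covering family of `X` has a member of zero activity (§5). W24's `locE_cube_eq` for ANY footprint. [folklore] -/
theorem locE_eq_polymerLogZ_of_support_single (hsymm : ∀ a b, ι a b → ι b a) (cubes : Dom → Finset Cube) (w : Dom → ℂ)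
    {X : Finset Cube} {p : Dom} (hp : cubes p = X) (hw : ∀ Z, cubes Z ⊆ X → Z ≠ p → w Z = 0) :
    locE ι cubes w X = polymerLogZ ι w {p} := by
  unfold locE
  rw [Finset.sum_eq_single {p}]
  · exact truncatedWeight_single w p
  · intro C hC hne
    obtain ⟨-, hU⟩ := mem_coveringFamilies.1 hC
    by_cases h : ∃ Z ∈ C, Z ≠ p
    · obtain ⟨Z, hZC, hZp⟩ := h
      exact truncatedWeight_eq_zero_of_zero_mem hsymm w (hw Z (hU ▸ Finset.subset_biUnion_of_mem cubes hZC) hZp) hZC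
    · push Not at h
      rcases Finset.subset_singleton_iff.1 (fun Z hZ => Finset.mem_singleton.2 (h Z hZ)) with h0 | h0
      · rw [h0]; exact truncatedWeight_empty w
      · exact absurd h0 hne
  · intro h
    exact absurd (mem_coveringFamilies.2 ⟨Finset.subset_univ _, by rw [Finset.singleton_biUnion, hp]⟩) h

/-- **`exp E_w(X) = 1 + w P`** under single support and `‖w P‖ < 1` (the KP logarithm IS a logarithm along the ray `1 + t·w P ≠ 0`). [folklore] -/
theorem exp_locE_of_support_single (hsymm : ∀ a b, ι a b → ι b a) (cubes : Dom → Finset Cube) (w : Dom → ℂ)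
    {X : Finset Cube} {p : Dom} (hp : cubes p = X) (hw : ∀ Z, cubes Z ⊆ X → Z ≠ p → w Z = 0) (hsmall : ‖w p‖ < 1) :
    cexp (locE ι cubes w X) = 1 + w p := by
  rw [locE_eq_polymerLogZ_of_support_single ι hsymm cubes w hp hw, exp_polymerLogZ]
  · exact polymerPartitionFunction_single hsymm w p
  · intro t ht
    rw [polymerPartitionFunction_single hsymm]
    have h1 : ‖(t : ℂ) * w p‖ < 1 := by
      rw [norm_mul, Complex.norm_real, Real.norm_eq_abs, abs_of_nonneg ht.1]
      calc t * ‖w p‖ ≤ 1 * ‖w p‖ := by gcongr; exact ht.2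
        _ < 1 := by rw [one_mul]; exact hsmall
    intro h0
    have : (t : ℂ) * w p = -1 := by linear_combination h0
    rw [this, norm_neg, norm_one] at h1
    exact lt_irrefl _ h1

/-- **PAIR SUPPORT**: if, among the polymers inside `X`, the activity lives on TWO polymers `P ≠ Q` whose footprints are NOT `X` but
COVER `X`, then `E_w(X) = Φ^T({P, Q}; w)` — the only covering family of `X` without a dead member is the pair. [folklore] -/
theorem locE_eq_truncatedWeight_of_support_pair (hsymm : ∀ a b, ι a b → ι b a) (cubes : Dom → Finset Cube) (w : Dom → ℂ)
    {X : Finset Cube} {p q : Dom} (hpq : p ≠ q) (hU : cubes p ∪ cubes q = X) (hpX : cubes p ≠ X) (hqX : cubes q ≠ X)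
    (hw : ∀ Z, cubes Z ⊆ X → Z ≠ p → Z ≠ q → w Z = 0) :
    locE ι cubes w X = truncatedWeight ι w {p, q} := by
  unfold locE
  rw [Finset.sum_eq_single {p, q}]
  · intro C hC hne
    obtain ⟨-, hCU⟩ := mem_coveringFamilies.1 hC
    by_cases h : ∃ Z ∈ C, Z ≠ p ∧ Z ≠ q
    · obtain ⟨Z, hZC, hZp, hZq⟩ := h
      exact truncatedWeight_eq_zero_of_zero_mem hsymm w (hw Z (hCU ▸ Finset.subset_biUnion_of_mem cubes hZC) hZp hZq) hZC
    · push Not at h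
      have hsub : C ⊆ {p, q} := fun Z hZ => by
        rw [Finset.mem_insert, Finset.mem_singleton]
        by_cases hZp : Z = p
        · exact Or.inl hZp
        · exact Or.inr (h Z hZ hZp)
      -- `C ⊊ {p, q}` cannot cover `X`: `∅`, `{p}`, `{q}` have unions `∅`, `cubes p ≠ X`, `cubes q ≠ X`
      exfalso
      have hXne : X.Nonempty := by
        rw [Finset.nonempty_iff_ne_empty]; intro hX
        apply hpX
        have hp0 : cubes p ⊆ ∅ := by rw [← hX, ← hU]; exact Finset.subset_union_left
        rw [Finset.subset_empty.1 hp0, hX]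
      by_cases hpC : p ∈ C
      · have hqC : q ∉ C := fun hqC => hne (Finset.Subset.antisymm hsub (by
          intro Z hZ; rw [Finset.mem_insert, Finset.mem_singleton] at hZ; rcases hZ with rfl | rfl; exacts [hpC, hqC]))
        have hC' : C = {p} := by
          ext Z; rw [Finset.mem_singleton]; constructor
          · intro hZ
            by_cases hZp : Z = p
            · exact hZp
            · exact absurd ((h Z hZ hZp) ▸ hZ) hqC
          · rintro rfl; exact hpC
        rw [hC', Finset.singleton_biUnion] at hCU; exact hpX hCU
      · have hC' : C ⊆ {q} := fun Z hZ => by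
          by_cases hZp : Z = p
          · exact absurd (hZp ▸ hZ) hpC
          · exact Finset.mem_singleton.2 (h Z hZ hZp)
        rcases Finset.subset_singleton_iff.1 hC' with h0 | h0
        · rw [h0, Finset.biUnion_empty] at hCU; exact hXne.ne_empty hCU.symm
        · rw [h0, Finset.singleton_biUnion] at hCU; exact hqX hCU
  · intro h
    refine absurd (mem_coveringFamilies.2 ⟨Finset.subset_univ _, ?_⟩) h
    rw [Finset.biUnion_insert, Finset.singleton_biUnion, hU]

/-- **`exp E_w(X) = (1 + w P + w Q)∕((1 + w P)(1 + w Q))`** under pair support by an INCOMPATIBLE pair with `‖w P‖, ‖w Q‖ < ½`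
(`exp Φ^T({P,Q}) = Z({P,Q})∕(Z({P})·Z({Q}))`, [KP86] (2)–(3) for two polymers). [folklore] -/
theorem exp_locE_of_support_pair (hsymm : ∀ a b, ι a b → ι b a) (cubes : Dom → Finset Cube) (w : Dom → ℂ)
    {X : Finset Cube} {p q : Dom} (hpq : p ≠ q) (hinc : ι p q) (hU : cubes p ∪ cubes q = X) (hpX : cubes p ≠ X) (hqX : cubes q ≠ X)
    (hw : ∀ Z, cubes Z ⊆ X → Z ≠ p → Z ≠ q → w Z = 0) (hsp : ‖w p‖ < 1 / 2) (hsq : ‖w q‖ < 1 / 2) :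
    cexp (locE ι cubes w X) = (1 + w p + w q) / ((1 + w p) * (1 + w q)) := by
  -- along the ray `t ∈ [0,1]` the three volumes do not vanish
  have hray : ∀ t ∈ Set.Icc (0 : ℝ) 1, ∀ z : ℂ, ‖z‖ < 1 / 2 → ‖(t : ℂ) * z‖ < 1 / 2 := fun t ht z hz => by
    rw [norm_mul, Complex.norm_real, Real.norm_eq_abs, abs_of_nonneg ht.1]
    calc t * ‖z‖ ≤ 1 * ‖z‖ := by gcongr; exact ht.2
      _ < 1 / 2 := by rw [one_mul]; exact hz
  have hne1 : ∀ z : ℂ, ‖z‖ < 1 / 2 → 1 + z ≠ 0 := fun z hz h0 => by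
    have : z = -1 := by linear_combination h0
    rw [this, norm_neg, norm_one] at hz; norm_num at hz
  have hne2 : ∀ z z' : ℂ, ‖z‖ < 1 / 2 → ‖z'‖ < 1 / 2 → 1 + z + z' ≠ 0 := fun z z' hz hz' h0 => by
    have : z + z' = -1 := by linear_combination h0
    have h := norm_add_le z z'
    rw [this, norm_neg, norm_one] at h; linarith
  have hZp : ∀ t ∈ Set.Icc (0 : ℝ) 1, polymerPartitionFunction ι (fun γ => (t : ℂ) * w γ) {p} ≠ 0 := fun t ht => by
    rw [polymerPartitionFunction_single hsymm]; exact hne1 _ (hray t ht _ hsp)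
  have hZq : ∀ t ∈ Set.Icc (0 : ℝ) 1, polymerPartitionFunction ι (fun γ => (t : ℂ) * w γ) {q} ≠ 0 := fun t ht => by
    rw [polymerPartitionFunction_single hsymm]; exact hne1 _ (hray t ht _ hsq)
  have hZpq : ∀ t ∈ Set.Icc (0 : ℝ) 1, polymerPartitionFunction ι (fun γ => (t : ℂ) * w γ) {p, q} ≠ 0 := fun t ht => by
    rw [polymerPartitionFunction_pair_of_inc hsymm _ hpq hinc]; exact hne2 _ _ (hray t ht _ hsp) (hray t ht _ hsq)
  rw [locE_eq_truncatedWeight_of_support_pair ι hsymm cubes w hpq hU hpX hqX hw, truncatedWeight_pair w hpq, sub_sub,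
    Complex.exp_sub, Complex.exp_add, exp_polymerLogZ hZpq, exp_polymerLogZ hZp, exp_polymerLogZ hZq,
    polymerPartitionFunction_pair_of_inc hsymm _ hpq hinc, polymerPartitionFunction_single hsymm,
    polymerPartitionFunction_single hsymm]

end Support

/-! ## §7 GENUINE ON PART 1's DATUM: the attached part of `E(C_R)` is the Ursell term of the two overlapping dominoes — NOT zero — although
NO active polymer has footprint `C_R`; with PART 1's bound on the SAME datum -/

section Live
variable (L N' : ℕ) [NeZero L] [NeZero N']

/-- **NO ACTIVE POLYMER HAS THE ROD AS FOOTPRINT**: the pencil vanishes on `C_R` itself (`5 ≤ L`: the rod is neither domino). [folklore] -/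
theorem actAB_CR (hL : 5 ≤ L) (c : ℝ) (s : ℂ) : actAB L N' c s (CR L N') = 0 :=
  actAB_of_ne L N' c s (DA_ne_CR L N' hL).symm (DB_ne_CR L N' hL).symm

/-- The two dominoes OVERLAP in the cube `proj p₁`, hence are INCOMPATIBLE for (2.11)'s ζ (pv22's `TTouch`). [folklore] -/
theorem ttouch_DA_DB : TTouch (DA L N') (DB L N') := by
  refine ⟨proj (L * N') (pR L 1), ?_, proj (L * N') (pR L 1), ?_, Or.inl rfl⟩
  · rw [DA_val]; unfold domT domW; exact Finset.mem_image_of_mem _ (by simp)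
  · rw [DB_val]; unfold domT domW; exact Finset.mem_image_of_mem _ (by simp)

/-- The activity slope is below `½` (indeed `c = A·e^{−5}∕2·e^{−R₁}` with `A ≤ 1`, W24's `dressedConst_le_one`). [arith] -/
theorem cAB_lt_half : cAB < 1 / 2 := by
  unfold cAB Aone
  have hA : Acst ≤ 1 := dressedConst_le_one
  have hA0 := Acst_pos
  have h5 : Real.exp (-5) < 1 := Real.exp_lt_one_iff.2 (by norm_num)
  have hR : Real.exp (-Rone) < 1 := Real.exp_lt_one_iff.2 (by linarith [Rone_pos])
  have h5' := Real.exp_pos (-5)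
  have hR' := Real.exp_pos (-Rone)
  nlinarith [mul_pos h5' hR', mul_lt_mul'' h5 hR h5'.le hR'.le]

open Classical in
/-- **THE ATTACHED PART AT THE ROD IS THE TWO-DOMINO URSELL TERM**: for a slope `0 ≤ c < ½`,
`exp E_{H_1}(C_R) = (1 + 2c)∕(1 + c)²` — §6's pair formula at `(P, Q) = (D_A, D_B)` on pv22's torus (`5 ≤ L`); i.e.
`E_{H_1}(C_R) = log(1 + 2c) − 2·log(1 + c) = −c² + O(c³)`, print's (2.13) at n = 2 with `ρ^T(D_A, D_B) = −1`. [folklore] -/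
theorem exp_locE_rod (hL : 5 ≤ L) {c : ℝ} (hc : 0 ≤ c) (hc2 : c < 1 / 2) :
    cexp (locE (tgeometry 4 (L * N')).ι (tgeometry 4 (L * N')).cubes (actAB L N' c 1) ((tgeometry 4 (L * N')).cubes (CR L N'))) =
      (1 + c + c) / ((1 + c) * (1 + c)) := by
  have hn : ‖(1 : ℂ) * (c : ℂ)‖ < 1 / 2 := by
    rw [one_mul, Complex.norm_real, Real.norm_eq_abs, abs_of_nonneg hc]; exact hc2
  have h := exp_locE_of_support_pair (tgeometry 4 (L * N')).ι (tgeometry 4 (L * N')).ι_symm (tgeometry 4 (L * N')).cubes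
    (actAB L N' c 1) (DA_ne_DB L N' hL) (ttouch_DA_DB L N') (footprints L N' hL).1 (footprints L N' hL).2.1 (footprints L N' hL).2.2
    (fun Z _ hA hB => actAB_of_ne L N' c 1 hA hB) (by rw [actAB_DA]; exact hn) (by rw [actAB_DB]; exact hn)
  rw [actAB_DA, actAB_DB, one_mul] at h
  exact h

open Classical in
/-- At the origin of the source every activity vanishes and `exp E_{H_0}(C_R) = 1`. [folklore] -/
theorem exp_locE_rod_zero (hL : 5 ≤ L) (c : ℝ) :
    cexp (locE (tgeometry 4 (L * N')).ι (tgeometry 4 (L * N')).cubes (actAB L N' c 0) ((tgeometry 4 (L * N')).cubes (CR L N'))) = 1 := by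
  have h0 : ‖(0 : ℂ)‖ < 1 / 2 := by rw [norm_zero]; norm_num
  have h := exp_locE_of_support_pair (tgeometry 4 (L * N')).ι (tgeometry 4 (L * N')).ι_symm (tgeometry 4 (L * N')).cubes
    (actAB L N' c 0) (DA_ne_DB L N' hL) (ttouch_DA_DB L N') (footprints L N' hL).1 (footprints L N' hL).2.1 (footprints L N' hL).2.2
    (fun Z _ hA hB => actAB_of_ne L N' c 0 hA hB) (by rw [actAB_zero]; exact h0) (by rw [actAB_zero]; exact h0)
  rw [actAB_zero, actAB_zero] at h
  norm_num at h
  exact h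

open Classical in
/-- **THE CLUSTER TERM IS LIVE**: `E_{H_1}(C_R) ≠ E_{H_0}(C_R)` — the quantity bounded by PART 1's `rodRateOne_fires` is NOT zero, although NO
active polymer has footprint `C_R` (`actAB_CR`): exponentials `(1 + 2c)∕(1 + c)² ≠ 1` since `c² ≠ 0`. [folklore] -/
theorem rodCluster_live (hL : 5 ≤ L) :
    locE (tgeometry 4 (L * N')).ι (tgeometry 4 (L * N')).cubes (actAB L N' cAB 1) ((tgeometry 4 (L * N')).cubes (CR L N')) ≠
      locE (tgeometry 4 (L * N')).ι (tgeometry 4 (L * N')).cubes (actAB L N' cAB 0) ((tgeometry 4 (L * N')).cubes (CR L N')) := by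
  intro h
  have h1 := exp_locE_rod L N' hL cAB_pos.le cAB_lt_half
  rw [h, exp_locE_rod_zero L N' hL] at h1
  have hc : (0 : ℝ) < cAB := cAB_pos
  have hne : (1 + (cAB : ℂ)) * (1 + cAB) ≠ 0 := by
    have : (1 + (cAB : ℂ)) ≠ 0 := by
      intro h0; have := congrArg Complex.re h0; simp at this; linarith
    exact mul_ne_zero this this
  rw [eq_div_iff hne, one_mul] at h1
  have h2 := congrArg Complex.re h1
  simp only [Complex.add_re, Complex.one_re, Complex.ofReal_re, Complex.mul_re, Complex.add_im, Complex.one_im,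
    Complex.ofReal_im, add_zero, mul_zero, sub_zero] at h2
  nlinarith

open Classical in
/-- **THE FACE FIRES ON A LIVE CLUSTER DATUM WITH THE DECAY COLLECTED**: PART 1's bound `≤ 2·K₀(64,8)·e^{−6}` AND the bounded quantity is
not zero, on the SAME datum, every `5 ≤ L`, every `N′`. [folklore] -/
example (hL : 5 ≤ L) :
    locE (tgeometry 4 (L * N')).ι (tgeometry 4 (L * N')).cubes (actAB L N' cAB 1) ((tgeometry 4 (L * N')).cubes (CR L N')) ≠
        locE (tgeometry 4 (L * N')).ι (tgeometry 4 (L * N')).cubes (actAB L N' cAB 0) ((tgeometry 4 (L * N')).cubes (CR L N')) ∧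
      ‖locE (tgeometry 4 (L * N')).ι (tgeometry 4 (L * N')).cubes (actAB L N' cAB 1) ((tgeometry 4 (L * N')).cubes (CR L N')) -
          locE (tgeometry 4 (L * N')).ι (tgeometry 4 (L * N')).cubes (actAB L N' cAB 0) ((tgeometry 4 (L * N')).cubes (CR L N'))‖ ≤
        2 * K₀ 64 8 * Real.exp (-6) :=
  ⟨rodCluster_live L N' hL, rodRateOne_fires_closed L N' hL⟩

end Live

end Summit.QuantumFields.BalabanUV.T4Continuum.NE1p.DressedSmallFieldRodRateWitness

end
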